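import Mathlib
import Summits.NavierStokesRegularity.NavierStokesRegularity.Theses.RootDecompFactorLadder
import Summits.NavierStokesRegularity.NavierStokesRegularity.Theorems.CorkscrewDynamoCorkscrewProfileRdssIterate
import Summits.NavierStokesRegularity.NavierStokesRegularity.Theorems.RdssProfileTruncation.Negative.FactorGuard
import Literature.Analysis.FluidPDE.SelfSimilar
import Literature.Analysis.FluidPDE.TypeIAncientMild
import Literature.Analysis.FluidPDE.PineauVicolRDSSTuning

/-!
# N26 «THE FACTOR LADDER» · X₂ TWO-FACTOR EXTRACTION ⟹ S GAP TRANSFER (lens-1 g12 «TWO TUNINGS», PROVED transfer)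

Critic row 174 (iv), optional booking: the one analytic stub X₂ «TWO-FACTOR EXTRACTION» of lens-1 g12 (a sequence of
nontrivial members of W's class with a common Type-I envelope, each rotated-DSS with a factor in `(1, 2]`, carrying
symmetries `(aₙ, Rₙ) → 2`, `(bₙ, Sₙ) → 3`, admits a nontrivial member which is `(2, R')`- and `(3, S')`-RDSS) implies the
route support S `GapTransfer` (stmt-33314: A `AccumulatingFactorLiouville` ⟹ NEAR `NearIdentityGap`) of
`Theses/RootDecompFactorLadder.lean`, BY NAME.  Proof (lens `gapTransfer_of_twoFactorExtraction`): if NEAR fails at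
envelope `C₀`, pick nontrivial members with factors `cₙ ∈ (1, 1 + 1/(n+1))`; the tuned powers `cₙ^⌊log μ / log cₙ⌋ → μ`
(`PineauVicol2026.tendsto_pow_natFloor_log`) are again factors (`isRotatedDSS_pow_exists`) for `μ = 2, 3`; X₂ extracts a
nontrivial member with factors `2` and `3`; TWO INCOMMENSURABLE FACTORS FORCE ACCUMULATION (`accumulates_of_two_three`:
the log-symmetry subgroup of `ℝ` is dense or cyclic, and a cyclic group containing `log 2, log 3` gives `2^N = 3^M`);
A kills it.  X₂ is spelled inline (it is not a rendered item; ledger-only add pending the farm); no defs — the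
log-symmetry subgroup is built inside the proof.

Sources: Pineau–Vicol 2026 (RDSS tuning); Chae–Wolf 2019 (removing DSS); KNSS 2009 Lemma 6.1; Mathlib
`AddSubgroup.dense_or_cyclic`; lens file HOME/decomp-ns-lens-1/TwoTunings.lean §2–§3.
-/

noncomputable section

set_option linter.dupNamespace false

namespace Summit.NavierStokesRegularity.NavierStokesRegularity.Theorems.RootDecompFactorLadderTwoFactorTransfer

open Summit.NavierStokesRegularity.NavierStokesRegularity.Theses
open Summit.NavierStokesRegularity.NavierStokesRegularity.Theorems
open scoped Topology
open Filter Set MeasureTheory Function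
open Literature.Analysis.FluidPDE

section SymmetryGroup

variable {E : Type*} [NormedAddCommGroup E] [NormedSpace ℝ E]

/-- `(cᵏ, Qₖ)`-RDSS for some isometry `Qₖ`, from `(c, R)`-RDSS (iterate the group law). -/
theorem isRotatedDSS_pow_exists {u : ℝ → E → E} {c : ℝ} {R : E ≃ₗᵢ[ℝ] E} (h : IsRotatedDSS c R u) :
    ∀ k : ℕ, ∃ Q : E ≃ₗᵢ[ℝ] E, IsRotatedDSS (c ^ k) Q u
  | 0 => ⟨LinearIsometryEquiv.refl ℝ E, by
      rw [pow_zero]; exact RdssProfileTruncation.Negative.isRotatedDSS_one_refl' u⟩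
  | k + 1 => by
      obtain ⟨Q, hQ⟩ := isRotatedDSS_pow_exists h k
      exact ⟨Q.trans R, by rw [pow_succ]; exact CorkscrewProfile.Birth.IsRotatedDSS.trans_mul hQ h⟩

/-- **TWO INCOMMENSURABLE FACTORS FORCE ACCUMULATION.** A field that is `(2, R)`-RDSS and `(3, S)`-RDSS for ANY
isometries `R, S` has an accumulating factor set (factors in every `(1, 1 + ε)`): the log-symmetry subgroup
`{s : (eˢ, Q)-RDSS for some isometry Q} ≤ ℝ` (built inside the proof) is dense or cyclic
(`AddSubgroup.dense_or_cyclic`); dense gives the factors, and a cyclic group containing `log 2, log 3` would give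
`2^N = 3^M` with `N ≥ 1`. -/
theorem accumulates_of_two_three {u : ℝ → E → E} {R S : E ≃ₗᵢ[ℝ] E} (h2 : IsRotatedDSS 2 R u)
    (h3 : IsRotatedDSS 3 S u) :
    ∀ ε : ℝ, 0 < ε → ∃ (c : ℝ) (Q : E ≃ₗᵢ[ℝ] E), 1 < c ∧ c < 1 + ε ∧ IsRotatedDSS c Q u := by
  -- the log-symmetry subgroup of `ℝ`
  let G : AddSubgroup ℝ :=
    { carrier := {s | ∃ Q : E ≃ₗᵢ[ℝ] E, IsRotatedDSS (Real.exp s) Q u}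
      zero_mem' := ⟨LinearIsometryEquiv.refl ℝ E, by
        rw [Real.exp_zero]; exact RdssProfileTruncation.Negative.isRotatedDSS_one_refl' u⟩
      add_mem' := by
        rintro a b ⟨Ra, hRa⟩ ⟨Sb, hSb⟩
        exact ⟨Ra.trans Sb, by rw [Real.exp_add]; exact CorkscrewProfile.Birth.IsRotatedDSS.trans_mul hRa hSb⟩
      neg_mem' := by
        rintro a ⟨Ra, hRa⟩
        exact ⟨Ra.symm, by
          rw [Real.exp_neg]; exact RdssProfileTruncation.Negative.isRotatedDSS_inv' hRa (Real.exp_pos a).ne'⟩ }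
  have hmemG : ∀ s : ℝ, s ∈ G ↔ ∃ Q : E ≃ₗᵢ[ℝ] E, IsRotatedDSS (Real.exp s) Q u := fun s => Iff.rfl
  have hlogmem : ∀ {c : ℝ} {Q : E ≃ₗᵢ[ℝ] E}, 0 < c → IsRotatedDSS c Q u → Real.log c ∈ G :=
    fun {c} {Q} hc h => (hmemG _).2 ⟨Q, by rwa [Real.exp_log hc]⟩
  intro ε hε
  rcases AddSubgroup.dense_or_cyclic G with hd | ⟨a, ha⟩
  · -- dense: a member of `G` in `(log 1, log (1 + ε)) = (0, log (1 + ε))`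
    have h1ε : (1 : ℝ) < 1 + ε := by linarith
    obtain ⟨s, hs, hs1, hs2⟩ : ∃ s ∈ (G : Set ℝ), Real.log 1 < s ∧ s < Real.log (1 + ε) := by
      obtain ⟨s, hs, hI⟩ := hd.exists_mem_open isOpen_Ioo (nonempty_Ioo.2 (Real.log_lt_log one_pos h1ε))
      exact ⟨s, hs, hI.1, hI.2⟩
    obtain ⟨Q, hQ⟩ := (hmemG s).1 hs
    refine ⟨Real.exp s, Q, ?_, ?_, hQ⟩
    · have h := Real.exp_lt_exp.2 hs1
      rwa [Real.log_one, Real.exp_zero] at h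
    · have h := Real.exp_lt_exp.2 hs2
      rwa [Real.exp_log (by linarith)] at h
  · exfalso
    have hmem : ∀ s, s ∈ G ↔ ∃ n : ℤ, n • a = s := fun s => by
      rw [ha, AddSubgroup.mem_closure_singleton]
    obtain ⟨m, hm⟩ := (hmem _).1 (hlogmem two_pos h2)
    obtain ⟨n, hn⟩ := (hmem _).1 (hlogmem three_pos h3)
    have hlog2 : 0 < Real.log 2 := Real.log_pos one_lt_two
    have hlog3 : 0 < Real.log 3 := Real.log_pos (by norm_num)
    -- cross-multiplied: n · log 2 = m · log 3
    have hcross : (n : ℝ) * Real.log 2 = (m : ℝ) * Real.log 3 := by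
      rw [← hm, ← hn, zsmul_eq_mul, zsmul_eq_mul]; ring
    have habs : (n.natAbs : ℝ) * Real.log 2 = (m.natAbs : ℝ) * Real.log 3 := by
      have h := congrArg abs hcross
      rw [abs_mul, abs_mul, abs_of_pos hlog2, abs_of_pos hlog3] at h
      have e1 : ((n.natAbs : ℕ) : ℝ) = |(n : ℝ)| := by
        rw [Nat.cast_natAbs, Int.cast_abs]
      have e2 : ((m.natAbs : ℕ) : ℝ) = |(m : ℝ)| := by
        rw [Nat.cast_natAbs, Int.cast_abs]
      rw [e1, e2]
      exact h
    have hpow : (2 : ℝ) ^ n.natAbs = (3 : ℝ) ^ m.natAbs := by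
      have e : Real.log ((2 : ℝ) ^ n.natAbs) = Real.log ((3 : ℝ) ^ m.natAbs) := by
        rw [Real.log_pow, Real.log_pow, habs]
      exact Real.log_injOn_pos (Set.mem_Ioi.2 (by positivity)) (Set.mem_Ioi.2 (by positivity)) e
    have hnat : 2 ^ n.natAbs = 3 ^ m.natAbs := by exact_mod_cast hpow
    rcases Nat.eq_zero_or_pos n.natAbs with h0 | hpos
    · rw [Int.natAbs_eq_zero.1 h0, zero_smul] at hn
      exact hlog3.ne' hn.symm
    · have h2dvd : 2 ∣ 3 ^ m.natAbs := by rw [← hnat]; exact dvd_pow_self 2 hpos.ne'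
      have h23 : 2 ∣ 3 := Nat.Prime.dvd_of_dvd_pow Nat.prime_two h2dvd
      omega

end SymmetryGroup

/-! ## The transfer X₂ ⟹ S -/

/-- **PROVED TRANSFER `X₂ ⟹ S`** — the route support `GapTransfer` (stmt-33314: `AccumulatingFactorLiouville →
NearIdentityGap`) of `Theses/RootDecompFactorLadder.lean`, BY NAME, from the two-factor extraction X₂ (inline). -/
theorem gapTransfer_of_twoFactorExtraction
    (hX :   ∀ (C₀ : ℝ) (u : ℕ → ℝ → EuclideanSpace ℝ (Fin 3) → EuclideanSpace ℝ (Fin 3)) (a b : ℕ → ℝ) (R S : ℕ → EuclideanSpace ℝ (Fin 3) ≃ₗᵢ[ℝ] EuclideanSpace ℝ (Fin 3)),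
      (∀ n, Literature.Analysis.FluidPDE.IsAncientMildSolution 1 (u n)) →
      (∀ n, ∀ t : ℝ, t < 0 → MeasureTheory.AEStronglyMeasurable (u n t) MeasureTheory.volume) →
      (∀ n, Literature.Analysis.FluidPDE.HasTypeIDecay C₀ (u n)) →
      (∀ n, ¬ ∀ t : ℝ, t < 0 → u n t =ᵐ[MeasureTheory.volume] 0) →
      (∀ n, ∃ (c : ℝ) (Q : EuclideanSpace ℝ (Fin 3) ≃ₗᵢ[ℝ] EuclideanSpace ℝ (Fin 3)), 1 < c ∧ c ≤ 2 ∧ Literature.Analysis.FluidPDE.IsRotatedDSS c Q (u n)) →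
      (∀ n, Literature.Analysis.FluidPDE.IsRotatedDSS (a n) (R n) (u n)) → (∀ n, Literature.Analysis.FluidPDE.IsRotatedDSS (b n) (S n) (u n)) →
      Filter.Tendsto a Filter.atTop (nhds 2) → Filter.Tendsto b Filter.atTop (nhds 3) →
      ∃ (C₁ : ℝ) (v : ℝ → EuclideanSpace ℝ (Fin 3) → EuclideanSpace ℝ (Fin 3)) (R' S' : EuclideanSpace ℝ (Fin 3) ≃ₗᵢ[ℝ] EuclideanSpace ℝ (Fin 3)),
        Literature.Analysis.FluidPDE.IsAncientMildSolution 1 v ∧ (∀ t : ℝ, t < 0 → MeasureTheory.AEStronglyMeasurable (v t) MeasureTheory.volume) ∧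
        Literature.Analysis.FluidPDE.HasTypeIDecay C₁ v ∧ (¬ ∀ t : ℝ, t < 0 → v t =ᵐ[MeasureTheory.volume] 0) ∧
        Literature.Analysis.FluidPDE.IsRotatedDSS 2 R' v ∧ Literature.Analysis.FluidPDE.IsRotatedDSS 3 S' v) :
    RootDecompFactorLadder.GapTransfer := by
  intro hA C₀
  by_contra hneg
  push Not at hneg
  -- nontrivial members below every threshold `1 + 1/(n+1)`
  have hbad : ∀ n : ℕ, ∃ (c : ℝ) (Q : EuclideanSpace ℝ (Fin 3) ≃ₗᵢ[ℝ] EuclideanSpace ℝ (Fin 3)) (u : ℝ → EuclideanSpace ℝ (Fin 3) → EuclideanSpace ℝ (Fin 3)), 1 < c ∧ c < 1 + 1 / ((n : ℝ) + 1) ∧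
      IsAncientMildSolution 1 u ∧ (∀ t : ℝ, t < 0 → AEStronglyMeasurable (u t) volume) ∧ IsRotatedDSS c Q u ∧
      HasTypeIDecay C₀ u ∧ ¬ ∀ t : ℝ, t < 0 → u t =ᵐ[volume] 0 := by
    intro n
    have hn : (0 : ℝ) < 1 / ((n : ℝ) + 1) := by positivity
    obtain ⟨c, Q, u, hc, hcΛ, hm, hme, hQ, hd, t, ht, hnt⟩ := hneg (1 + 1 / ((n : ℝ) + 1)) (by linarith)
    exact ⟨c, Q, u, hc, hcΛ, hm, hme, hQ, hd, fun hall => hnt (hall t ht)⟩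
  choose c Q u hc hcub hm hme hQ hd hnt using hbad
  -- `cₙ → 1`, `cₙ ≤ 2`
  have h0lim : Tendsto (fun n : ℕ => 1 / ((n : ℝ) + 1)) atTop (𝓝 0) := tendsto_one_div_add_atTop_nhds_zero_nat
  have hclim : Tendsto c atTop (𝓝 1) := by
    have hhi : Tendsto (fun n : ℕ => 1 + 1 / ((n : ℝ) + 1)) atTop (𝓝 1) := by
      have h := (tendsto_const_nhds (x := (1 : ℝ))).add h0lim
      rwa [add_zero] at h
    exact tendsto_of_tendsto_of_tendsto_of_le_of_le tendsto_const_nhds hhi (fun n => (hc n).le)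
      (fun n => (hcub n).le)
  have hc2 : ∀ n, c n ≤ 2 := fun n => by
    have h1 : 1 / ((n : ℝ) + 1) ≤ 1 := by
      rw [div_le_one (by positivity)]
      linarith [(Nat.cast_nonneg n : (0 : ℝ) ≤ n)]
    linarith [hcub n]
  -- the two tunings
  set a : ℕ → ℝ := fun n => c n ^ ⌊Real.log 2 / Real.log (c n)⌋₊ with ha_def
  set b : ℕ → ℝ := fun n => c n ^ ⌊Real.log 3 / Real.log (c n)⌋₊ with hb_def
  have ha : Tendsto a atTop (𝓝 2) := PineauVicol2026.tendsto_pow_natFloor_log hc hclim (by norm_num)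
  have hb : Tendsto b atTop (𝓝 3) := PineauVicol2026.tendsto_pow_natFloor_log hc hclim (by norm_num)
  have hRa : ∀ n, ∃ Ra : EuclideanSpace ℝ (Fin 3) ≃ₗᵢ[ℝ] EuclideanSpace ℝ (Fin 3), IsRotatedDSS (a n) Ra (u n) := fun n => isRotatedDSS_pow_exists (hQ n) _
  have hSb : ∀ n, ∃ Sb : EuclideanSpace ℝ (Fin 3) ≃ₗᵢ[ℝ] EuclideanSpace ℝ (Fin 3), IsRotatedDSS (b n) Sb (u n) := fun n => isRotatedDSS_pow_exists (hQ n) _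
  choose Ra hRa using hRa
  choose Sb hSb using hSb
  -- extract, then kill with A
  obtain ⟨C₁, v, R', S', hvm, hvme, hvd, hvnt, h2, h3⟩ :=
    hX C₀ u a b Ra Sb hm hme hd hnt (fun n => ⟨c n, Q n, hc n, hc2 n, hQ n⟩) hRa hSb ha hb
  exact hvnt (hA v hvm hvme ⟨C₁, hvd⟩ (accumulates_of_two_three h2 h3))

end Summit.NavierStokesRegularity.NavierStokesRegularity.Theorems.RootDecompFactorLadderTwoFactorTransfer

end
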